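import Mathlib
import Summits.KontsevichZagierPeriods.KontsevichZagierPeriods.Theorems.InverseLandauTateFamilyKernelStubSfLogCoeff

/-!
# Crux `TateFamilyKernel` (stmt-KontsevichZagierPeriods-9130), line `Sketch` — `stub_sfLogElim`

Step 3 (LOG-ELIMINATION ⇒ rational primitive along the polar curve) of the symmetric-fold class
`Q = 1 − ϖ z₁(1−z₁)(α + βz₂)` of the lead's skeleton of the crux
`Summit.KontsevichZagierPeriods.KontsevichZagierPeriods.Theses.InverseLandau.TateFamilyKernel`;
the algebraic half (the analytic half is `stub_sfLogCoeff`). Notation: `u = x(1−x)`,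
`L(x) = log|x| − log|1−x|`, `f_y(x) = P(x, (y/u − α)/β)/u`.

* `SfLogElim.exists_hat`: an `x ↦ 1−x`-even `P` is `P̂(u, s)` (`x^a + (1−x)^a ∈ ℚ[u]` by the
  two-step recursion), so `f_y = Σ c y^k u^{i−1−k}` is a Laurent polynomial in `u` alone
  (`SfLogElim.aeval_div_eq_sum_zpow`).
* `SfLogElim.prim`: each `u^e` has a primitive `q_e(x)/u^K + κ_e L(x)` off `{0,1}`, `q_e ∈ ℚ[x]`,
  `κ_e ∈ ℚ` (reduction formula `d/dx[(1−2x)u^m] = m u^{m−1} − (4m+2)u^m`, `prim_step`; down from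
  `∫ dx/u = L`, `prim_neg`, then up); so `F_y := R(y,x)/u^K + Λ(y) L(x)` is a primitive of `f_y`
  with `R ∈ ℚ[y,x]`, `Λ ∈ ℚ[y]` explicit finite sums over `supp P̂`.
* `stub_sfLogElim`: `stub_sfLogCoeff` (FTC in the fold coordinate + log elimination) gives `Λ = 0`,
  so `R/u^K` is the sought rational primitive, for every real `y`.

Mathlib + the landed `StubSfLogCoeff` / `StubLinResidues` files only; no named fact, no new
definition.
-/

noncomputable section

open MeasureTheory Set MvPolynomial
open scoped Topology

namespace Summit.KontsevichZagierPeriods.InverseLandau.TateFamilyKernel.Descent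

namespace SfLogElim

/-- `x^a + (1-x)^a` is a polynomial in `u = x(1-x)` (two-step recursion
`p_{a+2} = p_{a+1} - u p_a`, `p_0 = 2`, `p_1 = 1`). [folklore] -/
theorem exists_pow_add_pow (a : ℕ) : ∃ V : MvPolynomial (Fin 2) ℚ, ∀ x s : ℝ,
    aeval ![x * (1 - x), s] V = x ^ a + (1 - x) ^ a := by
  induction a using Nat.twoStepInduction with
  | zero => exact ⟨2, fun x s => by rw [map_ofNat]; ring⟩
  | one => exact ⟨1, fun x s => by rw [map_one]; ring⟩
  | more n h0 h1 =>
    obtain ⟨V0, hV0⟩ := h0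
    obtain ⟨V1, hV1⟩ := h1
    refine ⟨V1 - X 0 * V0, fun x s => ?_⟩
    rw [map_sub, map_mul, hV0, hV1, MvPolynomial.aeval_X, Matrix.cons_val_zero]
    ring

/-- Real evaluation of `P` as the sum of its monomials. [folklore] -/
theorem aeval_eq_sum (P : MvPolynomial (Fin 2) ℚ) (z : Fin 2 → ℝ) :
    aeval z P = ∑ m ∈ P.support, ((P.coeff m : ℚ) : ℝ) * (z 0 ^ (m 0) * z 1 ^ (m 1)) := by
  rw [MvPolynomial.aeval_def, MvPolynomial.eval₂_eq']
  exact Finset.sum_congr rfl fun m _ => by simp [Fin.prod_univ_two]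

/-- An `x ↦ 1 - x`-even `P(x,s)` is a polynomial in `(x(1-x), s)`: `P = ½(P + P∘g)` termwise and
`x^a + (1-x)^a ∈ ℚ[x(1-x)]`. [folklore] -/
theorem exists_hat (P : MvPolynomial (Fin 2) ℚ)
    (heven : ∀ z : Fin 2 → ℝ, aeval ![1 - z 0, z 1] P = aeval z P) :
    ∃ Ph : MvPolynomial (Fin 2) ℚ, ∀ x s : ℝ, aeval ![x, s] P = aeval ![x * (1 - x), s] Ph := by
  choose V hV using exists_pow_add_pow
  refine ⟨∑ m ∈ P.support, C (P.coeff m / 2) * V (m 0) * X 1 ^ (m 1), fun x s => ?_⟩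
  have h1 := heven ![x, s]
  simp only [Matrix.cons_val_zero, Matrix.cons_val_one] at h1
  have h2 : aeval ![x, s] P = (aeval ![x, s] P + aeval ![1 - x, s] P) / 2 := by rw [h1]; ring
  rw [h2, aeval_eq_sum, aeval_eq_sum, ← Finset.sum_add_distrib, Finset.sum_div]
  simp only [map_sum, map_mul, map_pow, MvPolynomial.aeval_C, MvPolynomial.aeval_X, hV,
    Matrix.cons_val_zero, Matrix.cons_val_one, eq_ratCast]
  refine Finset.sum_congr rfl fun m _ => ?_
  push_cast
  ring

/-- Laurent expansion along the polar curve: for `u ≠ 0`,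
`P̂(u, (y/u − α)/β)/u = Σ_{(i,j)} Σ_{k ≤ j} P̂_{ij} C(j,k) (−α)^{j−k} β^{−j} · y^k u^{i−1−k}`.
[folklore] -/
theorem aeval_div_eq_sum_zpow (α β : ℚ) (hβ : β ≠ 0) (Ph : MvPolynomial (Fin 2) ℚ) (y u : ℝ)
    (hu : u ≠ 0) :
    aeval ![u, (y / u - α) / β] Ph / u = ∑ m ∈ Ph.support, ∑ k ∈ Finset.range (m 1 + 1),
      ((Ph.coeff m * ((m 1).choose k : ℚ) * (-α) ^ (m 1 - k) / β ^ (m 1) : ℚ) : ℝ) * y ^ k *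
        u ^ ((m 0 : ℤ) - 1 - k) := by
  have hβ' : (β : ℝ) ≠ 0 := by exact_mod_cast hβ
  rw [aeval_eq_sum, Finset.sum_div]
  refine Finset.sum_congr rfl fun m _ => ?_
  simp only [Matrix.cons_val_zero, Matrix.cons_val_one]
  have key : (y / u - α) ^ (m 1) = ∑ k ∈ Finset.range (m 1 + 1),
      (y / u) ^ k * (-(α : ℝ)) ^ (m 1 - k) * ((m 1).choose k : ℝ) := by
    rw [sub_eq_add_neg, add_pow]
  rw [div_pow, key]
  simp only [Finset.mul_sum, Finset.sum_div]
  refine Finset.sum_congr rfl fun k _ => ?_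
  rw [zpow_sub₀ hu, zpow_sub₀ hu, zpow_natCast, zpow_natCast, zpow_one, div_pow]
  push_cast
  field_simp

/-- One reduction step for primitives of powers of `u = x(1−x)` on `ℝ ∖ {0,1}`: if
`m u^{m−1} − (4m+2) u^m` (`= d/dx[(1−2x)u^m]`) equals `A u^a + B u^b` with `B ≠ 0`, `m + K ≥ 0`,
and `q/u^K + κ L` (`L = log|x| − log|1−x|`) is a primitive of `u^a`, then `q'/u^K + κ' L`,
`q' = ((1−2x)u^{m+K} − A q)/B`, `κ' = −Aκ/B`, is a primitive of `u^b`. [folklore] -/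
theorem prim_step (K : ℕ) (m a b : ℤ) (A B : ℚ) (hB : B ≠ 0) (hm : 0 ≤ m + K)
    (hid : ∀ x : ℝ, x * (1 - x) ≠ 0 → (m : ℝ) * (x * (1 - x)) ^ (m - 1) -
      (4 * m + 2) * (x * (1 - x)) ^ m = (A : ℝ) * (x * (1 - x)) ^ a + B * (x * (1 - x)) ^ b)
    (q : MvPolynomial (Fin 2) ℚ) (κ : ℚ)
    (hq : ∀ y x : ℝ, x ≠ 0 → x ≠ 1 →
      HasDerivAt (fun x' : ℝ => aeval ![y, x'] q / (x' * (1 - x')) ^ K +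
        (κ : ℝ) * (Real.log x' - Real.log (1 - x'))) ((x * (1 - x)) ^ a) x) :
    ∃ (q' : MvPolynomial (Fin 2) ℚ) (κ' : ℚ), ∀ y x : ℝ, x ≠ 0 → x ≠ 1 →
      HasDerivAt (fun x' : ℝ => aeval ![y, x'] q' / (x' * (1 - x')) ^ K +
        (κ' : ℝ) * (Real.log x' - Real.log (1 - x'))) ((x * (1 - x)) ^ b) x := by
  refine ⟨C B⁻¹ * ((1 - 2 * X 1) * (X 1 * (1 - X 1)) ^ (m + K).toNat - C A * q), -(A * κ / B),
    fun y x hx h1x => ?_⟩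
  have hB' : (B : ℝ) ≠ 0 := by exact_mod_cast hB
  have hu : x * (1 - x) ≠ 0 := mul_ne_zero hx (sub_ne_zero.2 (Ne.symm h1x))
  have hlin : HasDerivAt (fun x' : ℝ => x' * (1 - x')) (1 - 2 * x) x :=
    ((hasDerivAt_id' x).fun_mul ((hasDerivAt_id' x).const_sub 1)).congr_deriv (by ring)
  -- `d/dx[(1 − 2x) u^m] = A u^a + B u^b`
  have hD : HasDerivAt (fun x' : ℝ => (1 - 2 * x') * (x' * (1 - x')) ^ m)
      ((A : ℝ) * (x * (1 - x)) ^ a + B * (x * (1 - x)) ^ b) x := by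
    have h3 : HasDerivAt (fun x' : ℝ => 1 - 2 * x') (-2 : ℝ) x :=
      (((hasDerivAt_id' x).const_mul (2 : ℝ)).const_sub 1).congr_deriv (by ring)
    refine (h3.fun_mul ((hasDerivAt_zpow m _ (Or.inl hu)).comp x hlin)).congr_deriv ?_
    rw [← hid x hu]
    simp only [Function.comp_apply]
    rw [zpow_sub_one₀ hu]
    field_simp
    ring
  have hev : ∀ᶠ x' in 𝓝 x, x' * (1 - x') ≠ 0 := hlin.continuousAt.eventually_ne hu
  refine (((hD.fun_sub ((hq y x hx h1x).const_mul (A : ℝ))).const_mul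
    ((B : ℝ)⁻¹)).congr_of_eventuallyEq (hev.mono fun x' hx' => ?_)).congr_deriv ?_
  · have hpow : (x' * (1 - x')) ^ (m + K).toNat = (x' * (1 - x')) ^ m * (x' * (1 - x')) ^ K := by
      rw [← zpow_natCast, Int.toNat_of_nonneg hm, zpow_add₀ hx', zpow_natCast]
    have haq : aeval ![y, x']
        (C B⁻¹ * ((1 - 2 * X 1) * (X 1 * (1 - X 1)) ^ (m + K).toNat - C A * q)) =
        (B : ℝ)⁻¹ * ((1 - 2 * x') * ((x' * (1 - x')) ^ m * (x' * (1 - x')) ^ K) -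
          A * aeval ![y, x'] q) := by
      simp only [map_mul, map_sub, map_pow, map_one, map_ofNat, MvPolynomial.aeval_C,
        MvPolynomial.aeval_X, Matrix.cons_val_one, Matrix.cons_val_fin_one, eq_ratCast, hpow]
      push_cast
      ring
    rw [haq]
    push_cast
    field_simp
    ring
  · field_simp
    ring

/-- Primitives `q/u^K + κ L` of `u^{−(n+1)}`, `n ≤ K` (downward recursion from `∫ dx/u = L`).
[folklore] -/
theorem prim_neg (K : ℕ) : ∀ n : ℕ, n ≤ K → ∃ (q : MvPolynomial (Fin 2) ℚ) (κ : ℚ),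
    ∀ y x : ℝ, x ≠ 0 → x ≠ 1 →
      HasDerivAt (fun x' : ℝ => aeval ![y, x'] q / (x' * (1 - x')) ^ K +
        (κ : ℝ) * (Real.log x' - Real.log (1 - x'))) ((x * (1 - x)) ^ (-((n : ℤ) + 1))) x := by
  intro n
  induction n with
  | zero =>
    intro _
    refine ⟨0, 1, fun y x hx h1x => ?_⟩
    have h1x' : (1 : ℝ) - x ≠ 0 := sub_ne_zero.2 (Ne.symm h1x)
    have h := (Real.hasDerivAt_log hx).fun_sub (((hasDerivAt_id' x).const_sub 1).log h1x')
    have hfun : (fun x' : ℝ => aeval ![y, x'] (0 : MvPolynomial (Fin 2) ℚ) / (x' * (1 - x')) ^ K +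
        ((1 : ℚ) : ℝ) * (Real.log x' - Real.log (1 - x'))) =
        fun x' => Real.log x' - Real.log (1 - x') := by
      funext x'
      simp
    rw [hfun]
    refine h.congr_deriv ?_
    rw [show -(((0 : ℕ) : ℤ) + 1) = -1 by norm_num, zpow_neg_one]
    field_simp
    ring
  | succ n ih =>
    intro hn
    obtain ⟨q, κ, hq⟩ := ih (by omega)
    obtain ⟨q', κ', h⟩ := prim_step K (-((n : ℤ) + 1)) (-((n : ℤ) + 1)) (-((n : ℤ) + 1) - 1)
      (4 * n + 2) (-((n : ℚ) + 1)) (by intro h0; linarith [n.cast_nonneg (α := ℚ)]) (by omega)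
      (fun x hx => by push_cast; ring) q κ hq
    refine ⟨q', κ', fun y x hx h1x => ?_⟩
    convert h y x hx h1x using 2
    push_cast
    ring

/-- Primitives of all the powers `u^{i−1−k}` that occur (`k ≤ K`), over the common denominator
`u^K`: `d/dx [q(x)/u^K + κ (log|x| − log|1−x|)] = u^{i−1−k}` off `{0,1}`, `q ∈ ℚ[y,x]`, `κ ∈ ℚ`
(upward recursion in `i` from `prim_neg`, `prim_step` with `m = i − k`). [folklore] -/
theorem prim (K i k : ℕ) : ∃ (q : MvPolynomial (Fin 2) ℚ) (κ : ℚ), k ≤ K →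
    ∀ y x : ℝ, x ≠ 0 → x ≠ 1 →
      HasDerivAt (fun x' : ℝ => aeval ![y, x'] q / (x' * (1 - x')) ^ K +
        (κ : ℝ) * (Real.log x' - Real.log (1 - x'))) ((x * (1 - x)) ^ ((i : ℤ) - 1 - k)) x := by
  by_cases hk : k ≤ K
  · induction i with
    | zero =>
      obtain ⟨q, κ, h⟩ := prim_neg K k hk
      exact ⟨q, κ, fun _ y x hx h1x => by convert h y x hx h1x using 2; push_cast; ring⟩
    | succ i ih =>
      obtain ⟨q, κ, hq⟩ := ih
      have hB : -(4 * ((i : ℚ) - k) + 2) ≠ 0 := fun h0 => by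
        have h1 : ((2 * ((i : ℤ) - k) + 1 : ℤ) : ℚ) = 0 := by push_cast; linarith
        exact absurd (by exact_mod_cast h1 : (2 * ((i : ℤ) - k) + 1 : ℤ) = 0) (by omega)
      obtain ⟨q', κ', h⟩ := prim_step K ((i : ℤ) - k) ((i : ℤ) - 1 - k) ((i : ℤ) - k)
        ((i : ℚ) - k) (-(4 * ((i : ℚ) - k) + 2)) hB (by omega)
        (fun x hx => by rw [show (i : ℤ) - k - 1 = (i : ℤ) - 1 - k by ring]; push_cast; ring)
        q κ (hq hk)
      exact ⟨q', κ', fun _ y x hx h1x => by convert h y x hx h1x using 2; push_cast; ring⟩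
  · exact ⟨0, 0, fun h => absurd h hk⟩

end SfLogElim

open SfLogElim in
/-- STUB `stub_sfLogElim` (symmetric-fold class, step 3: LOG-ELIMINATION on the conic ⇒ rational
primitive along the polar curve). For `x ↦ 1−x`-even `P ∈ ℚ[x,s]`, `0 < α`, `0 < β`: if the fold
density `∫_{(4y−α)/β}^1 P(φ(s),s)/(w√(1−4y/w)) ds` vanishes on `(α/4, (α+β)/4)`, then
`x ↦ P(x, (y/u − α)/β)/u` (`u = x(1−x)`) has a rational primitive `R(y,x)/u^k`, `R ∈ ℚ[y,x]`, for
every real `y`, off `{0,1}`: `P = P̂(u,s)` (`exists_hat`), the explicit primitive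
`R/u^K + Λ(y)(log|x| − log|1−x|)` (`prim`), and `Λ = 0` by `stub_sfLogCoeff`.
[cite: KontsevichZagier2001, §1.2] -/
theorem stub_sfLogElim (α β : ℚ) (P : MvPolynomial (Fin 2) ℚ) (hα : 0 < α) (hβ : 0 < β)
    (heven : ∀ z : Fin 2 → ℝ, aeval ![1 - z 0, z 1] P = aeval z P)
    (hΦ : ∀ y ∈ Ioo ((α : ℝ) / 4) (((α : ℝ) + β) / 4), ∫ s in Ioo ((4 * y - α) / β) 1,
      aeval ![(1 - Real.sqrt (1 - 4 * y / ((α : ℝ) + β * s))) / 2, s] P /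
        (((α : ℝ) + β * s) * Real.sqrt (1 - 4 * y / ((α : ℝ) + β * s))) = 0) :
    ∃ (k : ℕ) (R : MvPolynomial (Fin 2) ℚ), ∀ (y x : ℝ), x ≠ 0 → x ≠ 1 →
      HasDerivAt (fun x' : ℝ => aeval ![y, x'] R / (x' * (1 - x')) ^ k)
        (aeval ![x, (y / (x * (1 - x)) - α) / β] P / (x * (1 - x))) x := by
  classical
  obtain ⟨Ph, hPh⟩ := exists_hat P heven
  set K : ℕ := Ph.support.sup (fun m => m 1) with hK
  have hKle : ∀ m ∈ Ph.support, m 1 ≤ K := fun m hm => Finset.le_sup (f := fun m => m 1) hm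
  choose q κ hq using prim K
  set R : MvPolynomial (Fin 2) ℚ := ∑ m ∈ Ph.support, ∑ k ∈ Finset.range (m 1 + 1),
    C (Ph.coeff m * ((m 1).choose k : ℚ) * (-α) ^ (m 1 - k) / β ^ (m 1)) * X 0 ^ k *
      q (m 0) k with hR
  set Λ : Polynomial ℚ := ∑ m ∈ Ph.support, ∑ k ∈ Finset.range (m 1 + 1),
    Polynomial.C (Ph.coeff m * ((m 1).choose k : ℚ) * (-α) ^ (m 1 - k) / β ^ (m 1) *
      κ (m 0) k) * Polynomial.X ^ k with hΛ
  -- `F_y = R(y,·)/u^K + Λ(y) L` is a primitive of `f_y` off `{0,1}`, for every real `y`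
  have hF : ∀ y x : ℝ, x ≠ 0 → x ≠ 1 → HasDerivAt (fun x' : ℝ => aeval ![y, x'] R /
      (x' * (1 - x')) ^ K + (Polynomial.aeval y Λ : ℝ) * (Real.log x' - Real.log (1 - x')))
      (aeval ![x, (y / (x * (1 - x)) - α) / β] P / (x * (1 - x))) x := by
    intro y x hx h1x
    have hu : x * (1 - x) ≠ 0 := mul_ne_zero hx (sub_ne_zero.2 (Ne.symm h1x))
    have h1 := HasDerivAt.fun_sum (u := Ph.support) fun m hm =>
      HasDerivAt.fun_sum (u := Finset.range (m 1 + 1)) fun k hk =>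
        (hq (m 0) k (by have := hKle m hm; simp only [Finset.mem_range] at hk; omega)
          y x hx h1x).const_mul
        (((Ph.coeff m * ((m 1).choose k : ℚ) * (-α) ^ (m 1 - k) / β ^ (m 1) : ℚ) : ℝ) * y ^ k)
    rw [hPh, aeval_div_eq_sum_zpow α β hβ.ne' Ph y _ hu]
    refine (h1.congr_of_eventuallyEq (Filter.Eventually.of_forall fun x' => ?_)).congr_deriv
      (Finset.sum_congr rfl fun m _ => Finset.sum_congr rfl fun k _ => by ring)
    simp only [hR, hΛ, map_sum, map_mul, map_pow, MvPolynomial.aeval_C, MvPolynomial.aeval_X,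
      Matrix.cons_val_zero, Polynomial.aeval_C, Polynomial.aeval_X, eq_ratCast, Finset.sum_div,
      Finset.sum_mul, ← Finset.sum_add_distrib]
    refine Finset.sum_congr rfl fun m _ => Finset.sum_congr rfl fun k _ => ?_
    push_cast
    ring
  -- the analytic half: the `log`-coefficient vanishes
  have hΛ0 : Λ = 0 := stub_sfLogCoeff α β P hα hβ hΦ K R Λ hF
  refine ⟨K, R, fun y x hx h1x => ?_⟩
  simpa only [hΛ0, map_zero, zero_mul, add_zero] using hF y x hx h1x

end Summit.KontsevichZagierPeriods.InverseLandau.TateFamilyKernel.Descent
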